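import Literature.NumberTheory.GaloisRepresentations.AbsIrreducibleIndexTwo
import HarnessLib

/-!
# Stable lines of a transvection in dimension two; index-two subgroups (representation theory)

HONEST FRAMING (cell `b2b-bsdres`, run/shared/lean/b2b/bsd-rank1-residual/, verbatim in every
file): the goal of the cell is to DELETE the COMBINATION-SHAPED residual classes of the
Birch–Swinnerton-Dyer formula for ALL analytic-rank `≤ 1` elliptic curves over `ℚ` — "full BSD
formula for every rank `≤ 1` curve in class `C`" assembled STRICTLY from published theorems — so
that the rank-`≤ 1` remainder becomes exactly the CONSTRUCTION-SHAPED classes, which are TYPED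
(missing-input `Prop`s), NOT attempted. This is not "finishing BSD". Sub-cell
`b2b-bsdres-multr1-p1` (X11b, route R1); no claim beyond the stated class; X11b stays
CONSTRUCTION-SHAPED; nothing here changes a label; no named fact (theorems only; no `sorry`).

Elementary representation theory used by `TransvectionAbsIrreducible.lean` (the "absolutely
irreducible over `G_K`" hypothesis of [FW21, Thm. 4.41] / [Cas20] on the cell's loci):
* `eq_ker_of_stable` — in dimension `2`, a proper nonzero subspace stable under `N` with `N ≠ 0`,
  `N² = 0` (i.e. under the transvection `1 + N`) is the line `ker N`;
* `isIrreducible_comp_of_index_two_of_transvection` — **over a field with `2 ≠ 0`, an irreducible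
  `2`-dimensional representation containing a transvection `π(g₀) = 1 + N` stays irreducible on
  every subgroup of index `2`**: an `H`-stable proper line `U` and its translate `U' = π(σ)U` are
  `H`-stable with `U ∩ U' = 0` (irreducibility), and both equal the kernel of a transvection lying
  in `H` (`π(g₀)` itself, or `π(g₀²) = 1 + 2N`) — contradiction. (False over `𝔽₂`:
  `GL₂(𝔽₂) ≅ S₃ ⊃ A₃`.) Companion of the tree's `Representation.isIrreducible_comp_of_index_two`
  (odd dimension, Clifford), which does not cover dimension `2`.

References: J.-P. Serre, Invent. Math. 15 (1972) §2 [Serre1972]; A. H. Clifford, Ann. of Math. 38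
(1937) [Clifford1937].
-/

noncomputable section

namespace Summit.BirchSwinnertonDyer.Rank1Residual.X11b.Transvection

universe u

/-! ### Linear algebra in dimension two: stable lines of a transvection -/

section LinearAlgebra

variable {k : Type u} [Field k] {V : Type*} [AddCommGroup V] [Module k V] [FiniteDimensional k V]

omit [FiniteDimensional k V] in
/-- Two vectors `u ∈ U`, `w ∉ U` with `u ≠ 0` are linearly independent. [folklore] -/
theorem linearIndependent_pair_of_mem_of_notMem {U : Submodule k V} {u w : V} (hu : u ∈ U)
    (hu0 : u ≠ 0) (hw : w ∉ U) : LinearIndependent k ![u, w] := by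
  refine LinearIndependent.pair_iff.2 fun s t hst => ?_
  by_cases ht : t = 0
  · subst ht
    simp only [zero_smul, add_zero, smul_eq_zero] at hst
    exact ⟨hst.resolve_right hu0, rfl⟩
  · exfalso
    apply hw
    have h1 : t • w = -(s • u) := eq_neg_of_add_eq_zero_right hst
    have h2 : w = t⁻¹ • (-(s • u)) := by
      rw [← h1, smul_smul, inv_mul_cancel₀ ht, one_smul]
    rw [h2]
    exact U.smul_mem _ (U.neg_mem (U.smul_mem _ hu))

/-- In a `2`-dimensional space two linearly independent vectors span everything. [folklore] -/
theorem span_pair_eq_top_of_linearIndependent (h2 : Module.finrank k V = 2) {u w : V}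
    (h : LinearIndependent k ![u, w]) : Submodule.span k (Set.range ![u, w]) = ⊤ := by
  apply Submodule.eq_top_of_finrank_eq
  rw [finrank_span_eq_card h, h2]
  simp

/-- **Stable lines of a transvection.** Let `dim V = 2` and `N : V → V` with `N ≠ 0`, `N² = 0`
(so `1 + N` is a transvection). A proper nonzero subspace `U` stable under `N` (equivalently under
`1 + N`) is the line `ker N`. Proof: if `N u ≠ 0` for some `u ∈ U` then `u, N u` are independent
and lie in `U`, so `U = V`; hence `U ⊆ ker N`, and a proper nonzero subspace of the line `ker N`
(`N ≠ 0`) is all of it. [folklore] -/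
theorem eq_ker_of_stable (h2 : Module.finrank k V = 2) {N : V →ₗ[k] V} (hN : N ≠ 0)
    (hNN : N ∘ₗ N = 0) {U : Submodule k V} (hU : ∀ v ∈ U, N v ∈ U) (hb : U ≠ ⊥) (ht : U ≠ ⊤) :
    U = LinearMap.ker N := by
  -- Step 1: `N` kills `U`
  have hNU : ∀ u ∈ U, N u = 0 := by
    intro u hu
    by_contra hNu
    apply ht
    have hind : LinearIndependent k ![u, N u] := by
      refine LinearIndependent.pair_iff.2 fun s t hst => ?_
      have h1 : s • N u = 0 := by
        have := congrArg N hst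
        simp only [map_add, map_smul, map_zero] at this
        have hNNu : N (N u) = 0 := by
          have := LinearMap.congr_fun hNN u
          simpa using this
        rwa [hNNu, smul_zero, add_zero] at this
      have hs : s = 0 := (smul_eq_zero.1 h1).resolve_right hNu
      subst hs
      simp only [zero_smul, zero_add, smul_eq_zero] at hst
      exact ⟨rfl, hst.resolve_right hNu⟩
    have htop := span_pair_eq_top_of_linearIndependent h2 hind
    rw [eq_top_iff, ← htop, Submodule.span_le]
    rintro _ ⟨i, rfl⟩
    fin_cases i
    · exact hu
    · exact hU u hu
  -- Step 2: `U ≤ ker N`, and equality by dimension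
  have hle : U ≤ LinearMap.ker N := fun u hu => LinearMap.mem_ker.2 (hNU u hu)
  refine le_antisymm hle ?_
  by_contra hnot
  obtain ⟨w, hwK, hwU⟩ := Set.not_subset.1 hnot
  obtain ⟨u, huU, hu0⟩ := Submodule.exists_mem_ne_zero_of_ne_bot hb
  have hind := linearIndependent_pair_of_mem_of_notMem huU hu0 hwU
  have htop := span_pair_eq_top_of_linearIndependent h2 hind
  apply hN
  apply LinearMap.ker_eq_top.1
  rw [eq_top_iff, ← htop, Submodule.span_le]
  rintro _ ⟨i, rfl⟩
  fin_cases i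
  · exact hle huU
  · exact hwK

omit [FiniteDimensional k V] in
/-- `ker N ≠ ⊥` for `N ≠ 0` with `N² = 0` (the image is a nonzero subspace of the kernel).
[folklore] -/
theorem ker_ne_bot_of_sq_eq_zero {N : V →ₗ[k] V} (hN : N ≠ 0) (hNN : N ∘ₗ N = 0) :
    LinearMap.ker N ≠ ⊥ := by
  obtain ⟨v, hv⟩ : ∃ v, N v ≠ 0 := by
    by_contra! h
    exact hN (LinearMap.ext h)
  intro hbot
  have : N v ∈ LinearMap.ker N := LinearMap.mem_ker.2 (by
    have := LinearMap.congr_fun hNN v; simpa using this)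
  rw [hbot, Submodule.mem_bot] at this
  exact hv this

omit [FiniteDimensional k V] in
/-- `ker N ≠ ⊤` for `N ≠ 0`. [folklore] -/
theorem ker_ne_top_of_ne_zero {N : V →ₗ[k] V} (hN : N ≠ 0) : LinearMap.ker N ≠ ⊤ :=
  fun h => hN (LinearMap.ker_eq_top.1 h)

end LinearAlgebra

/-! ### Representations: a transvection in the image -/

section Rep

variable {k : Type u} [Field k] {G H : Type*} [Group G] [Group H] {V : Type*} [AddCommGroup V]
  [Module k V] [FiniteDimensional k V] (π : Representation k G V)

omit [FiniteDimensional k V] in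
/-- A `π`-stable subspace is stable under `N = π(g₀) − 1`. [folklore] -/
theorem stable_of_eq_one_add {g₀ : G} {N : V →ₗ[k] V} (hg₀ : π g₀ = 1 + N)
    {U : Submodule k V} (hU : ∀ v ∈ U, π g₀ v ∈ U) : ∀ v ∈ U, N v ∈ U := by
  intro v hv
  have h := hU v hv
  rw [hg₀, LinearMap.add_apply, Module.End.one_apply] at h
  simpa using U.sub_mem h hv

/-- **Index two, with a transvection (characteristic `≠ 2`).** Let `π` be an IRREDUCIBLE
representation of `G` on a `2`-dimensional space over a field `k` with `2 ≠ 0`, suppose some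
`π(g₀) = 1 + N` is a transvection (`N ≠ 0`, `N² = 0`), and let `φ : H → G` have image `N'` of
index `2`. Then `π ∘ φ` is irreducible. Proof: an `N'`-stable proper line `U` and its translate
`U' = π(σ)U` (`σ ∉ N'`) are both `N'`-stable; `U + U'`, `U ∩ U'` are `G`-stable, so `U ⊕ U' = V`.
Some element of `N'` acts as a transvection `1 + N₁` (`g₀` itself if `g₀ ∈ N'`, else
`g₀² ∈ N'` with `N₁ = 2N ≠ 0`); then `U = ker N₁ = U'` (`eq_ker_of_stable`), contradiction.
(For `k = 𝔽₂` the statement fails: `GL₂(𝔽₂) ≅ S₃ ⊃ A₃`.) [folklore] -/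
theorem isIrreducible_comp_of_index_two_of_transvection (h2 : Module.finrank k V = 2)
    (hchar : (2 : k) ≠ 0) (hπ : π.IsIrreducible) {g₀ : G} {N : V →ₗ[k] V} (hg₀ : π g₀ = 1 + N)
    (hN : N ≠ 0) (hNN : N ∘ₗ N = 0) (φ : H →* G) (hφ : φ.range.index = 2) :
    Representation.IsIrreducible (π.comp φ) := by
  classical
  haveI := hπ
  set N' : Subgroup G := φ.range with hN'def
  haveI hN' : N'.Normal := Subgroup.normal_of_index_eq_two hφ
  obtain ⟨σ, hσ⟩ : ∃ g : G, g ∉ N' := by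
    by_contra! h
    have htop : N' = ⊤ := eq_top_iff.mpr fun x _ => h x
    rw [htop, Subgroup.index_top] at hφ
    exact absurd hφ (by norm_num)
  have hmul : ∀ {a b : G}, a ∉ N' → b ∉ N' → a * b ∈ N' := fun ha hb =>
    (Subgroup.mul_mem_iff_of_index_two hφ).mpr (iff_of_false ha hb)
  have hσinv : σ⁻¹ ∉ N' := fun h => hσ (by simpa using N'.inv_mem h)
  have hcomp : ∀ (a b : G) (v : V), π a (π b v) = π (a * b) v := fun a b v => by
    rw [map_mul]; rfl
  have hVbt : (⊥ : Submodule k V) ≠ ⊤ := fun h' =>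
    (bot_ne_top : (⊥ : Subrepresentation π) ≠ ⊤) (Subrepresentation.toSubmodule_injective h')
  haveI : Nontrivial (Subrepresentation (π.comp φ)) :=
    ⟨⟨⊥, ⊤, fun h => hVbt (congrArg Subrepresentation.toSubmodule h)⟩⟩
  refine ⟨fun W => ?_⟩
  by_contra hW
  obtain ⟨hWb, hWt⟩ := not_or.mp hW
  set U : Submodule k V := W.toSubmodule with hUdef
  have hUb : U ≠ ⊥ := fun h => hWb (Subrepresentation.toSubmodule_injective h)
  have hUt : U ≠ ⊤ := fun h => hWt (Subrepresentation.toSubmodule_injective h)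
  have hNU : ∀ x ∈ N', ∀ v ∈ U, π x v ∈ U := by
    rintro _ ⟨h, rfl⟩ v hv
    exact W.apply_mem_toSubmodule h hv
  set U' : Submodule k V := U.map (π σ) with hU'def
  have hNU' : ∀ x ∈ N', ∀ v ∈ U', π x v ∈ U' := by
    intro x hx v hv
    obtain ⟨u, hu, rfl⟩ := Submodule.mem_map.mp hv
    rw [hcomp, show x * σ = σ * (σ⁻¹ * x * σ) by group, ← hcomp]
    exact Submodule.mem_map_of_mem (hNU _ (by simpa using hN'.conj_mem x hx σ⁻¹) u hu)
  have hU_of_not : ∀ x ∉ N', ∀ v ∈ U, π x v ∈ U' := by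
    intro x hx v hv
    rw [show x = σ * (σ⁻¹ * x) by group, ← hcomp]
    exact Submodule.mem_map_of_mem (hNU _ (hmul hσinv hx) v hv)
  have hU'_of_not : ∀ x ∉ N', ∀ v ∈ U', π x v ∈ U := by
    intro x hx v hv
    obtain ⟨u, hu, rfl⟩ := Submodule.mem_map.mp hv
    rw [hcomp]
    exact hNU _ (hmul hx hσ) u hu
  -- `U ∩ U'` is `G`-stable, hence `⊥`
  let S₂ : Subrepresentation π := ⟨U ⊓ U', fun x v hv => by
    obtain ⟨hvU, hvU'⟩ := Submodule.mem_inf.mp hv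
    by_cases hx : x ∈ N'
    · exact Submodule.mem_inf.mpr ⟨hNU x hx v hvU, hNU' x hx v hvU'⟩
    · exact Submodule.mem_inf.mpr ⟨hU'_of_not x hx v hvU', hU_of_not x hx v hvU⟩⟩
  have h₂ : U ⊓ U' = ⊥ := by
    rcases IsSimpleOrder.eq_bot_or_eq_top S₂ with h | h
    · exact congrArg Subrepresentation.toSubmodule h
    · exfalso
      have : U ⊓ U' = ⊤ := congrArg Subrepresentation.toSubmodule h
      exact hUt (top_le_iff.mp (this.ge.trans inf_le_left))
  -- `U'` is a proper nonzero subspace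
  have hinj : Function.Injective (π σ) := by
    intro a b hab
    have := congrArg (π σ⁻¹) hab
    rwa [hcomp, hcomp, inv_mul_cancel, map_one, Module.End.one_apply, Module.End.one_apply] at this
  have hU'b : U' ≠ ⊥ := by
    intro h
    apply hUb
    refine (Submodule.eq_bot_iff _).2 fun v hv => hinj ?_
    have hv' : π σ v ∈ U' := Submodule.mem_map_of_mem hv
    rw [h, Submodule.mem_bot] at hv'
    rw [hv', map_zero]
  have hU't : U' ≠ ⊤ := by
    intro h
    apply hUb
    rw [← h₂, h, inf_top_eq]
  -- some element of `N'` acts as a transvection `1 + N₁`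
  obtain ⟨x, hxN', N₁, hx, hN₁, hN₁N₁⟩ :
      ∃ x ∈ N', ∃ N₁ : V →ₗ[k] V, π x = 1 + N₁ ∧ N₁ ≠ 0 ∧ N₁ ∘ₗ N₁ = 0 := by
    by_cases hg : g₀ ∈ N'
    · exact ⟨g₀, hg, N, hg₀, hN, hNN⟩
    · refine ⟨g₀ * g₀, hmul hg hg, (2 : k) • N, ?_, ?_, ?_⟩
      · rw [map_mul, hg₀]
        ext v
        have hNNv : N (N v) = 0 := by
          have := LinearMap.congr_fun hNN v; simpa using this
        simp [two_smul, hNNv, add_assoc]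
      · intro h
        exact hN ((smul_eq_zero.1 h).resolve_left hchar)
      · ext v
        have hNNv : N (N v) = 0 := by
          have := LinearMap.congr_fun hNN v; simpa using this
        simp [hNNv]
  -- hence `U = ker N₁ = U'`, contradicting `U ∩ U' = 0`
  have hU1 : U = LinearMap.ker N₁ :=
    eq_ker_of_stable h2 hN₁ hN₁N₁ (stable_of_eq_one_add π hx (hNU x hxN')) hUb hUt
  have hU'1 : U' = LinearMap.ker N₁ :=
    eq_ker_of_stable h2 hN₁ hN₁N₁ (stable_of_eq_one_add π hx (hNU' x hxN')) hU'b hU't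
  apply hUb
  rw [← h₂, hU1, hU'1, inf_idem]

/-- **A stable proper nonzero subspace is the kernel of the transvection** (no irreducibility
hypothesis; one field). [folklore] -/
theorem toSubmodule_eq_ker_of_transvection (h2 : Module.finrank k V = 2) {g₀ : G}
    {N : V →ₗ[k] V} (hg₀ : π g₀ = 1 + N) (hN : N ≠ 0) (hNN : N ∘ₗ N = 0)
    (W : Subrepresentation π) (hb : W ≠ ⊥) (ht : W ≠ ⊤) : W.toSubmodule = LinearMap.ker N :=
  eq_ker_of_stable h2 hN hNN
    (stable_of_eq_one_add π hg₀ fun _ hv => W.apply_mem_toSubmodule g₀ hv)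
    (fun h => hb (Subrepresentation.toSubmodule_injective h))
    (fun h => ht (Subrepresentation.toSubmodule_injective h))

end Rep

end Summit.BirchSwinnertonDyer.Rank1Residual.X11b.Transvection

end
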